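import Summits.FinalStateConjecture.FinalStateConjecture.Theorems.ClusterCompletenessOmegaLimitMultiKerrSketchInnerHorizonMasquerade
import HarnessLib

/-!
# Crux `ClusterCompleteness.OmegaLimitMultiKerr` (stmt-FinalStateConjecture-17639), line `Sketch` v8 —
# the INNER-HORIZON MASQUERADE, part 2: the inner boundary `{r_ν = 1}` is null for `G = B^* g_{M₁,1}`;
# the zeroth-order size `‖g_{1,a} − η‖ ≤ 8/r_a`

Part 2 of the wave-4 audit witness (part 1: `…SketchInnerHorizonMasquerade`; part 3 `…MasqueradeAnchor` uses the
zeroth-order size `norm_ksPert_one_le` proved here).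
The red-shift scalar of `G` in the label's radius `r_ν` is `F(x) = dr_ν(G⁻¹ dr_ν)(x)`.

* ON the boundary spheroid `{r_ν = 1}` (squeezed onto the inner horizon `{r_1 = ν}` of `g_{M₁,1}`,
  `M₁ = (1+ν²)/(2ν)`), the covector `dr_ν ∘ B⁻¹` is conormal to `{r_1 = ν}`: explicitly
  `dr_ν(x)(B⁻¹w) = c · dr_1(Bx)(w)`, `c = Σ₁/(ν Σ₀)` (`Kerr.radiusGrad_apply_sum`), whence
  `G⁻¹dr_ν = B⁻¹(c W₁)`, `W₁ = g_{M₁,1}⁻¹ dr_1` (`Kerr.bilin_radiusGradVector`), and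
  `F(x) = c² g_{M₁,1}(W₁, W₁) = c² Δ₁(ν)/Σ₁ = 0` since `Δ₁(ν) = ν² − 2M₁ν + 1 = 0`
  (`squeezed_redShift_boundary`);
* `F` is stationary and continuous up to the boundary (`G` is a smooth nondegenerate symmetric field on
  `B⁻¹{r_1 > 0} ⊇ {r_ν ≥ 1}`, `MetricCoord.IsMetricOn.contDiffOn_sharpAt`), so by compactness of the slice
  `{x⁰ = 0, 1 ≤ r_ν ≤ 2}` it is uniformly small near the boundary: `∀ ε > 0 ∃ δ > 0`, `|F| ≤ ε` on
  `{1 < r_ν < 1 + δ}` (`squeezed_null_boundary`) — hypothesis H7 of the no-hair stub.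
-/

set_option linter.dupNamespace false
set_option maxSynthPendingDepth 3

noncomputable section

open scoped Topology Manifold ContDiff RealInnerProductSpace
open Filter Set Function TopologicalSpace Literature.Geometry.Lorentzian

namespace Summit.FinalStateConjecture.FinalStateConjecture.Theorems.ClusterCompleteness

/-! ### Zeroth-order size of the Kerr–Schild perturbation -/

/-- `|ℓ(v)| ≤ 2‖v‖`: `ℓ(v) = v⁰ + ℓ⃗·v⃗` with `|ℓ⃗| = 1`. Visser arXiv:0706.0622, (34)–(35). [folklore] -/
theorem abs_nullCovector_le {a : ℝ} {y : E4} (hy : 0 < Kerr.radius a y) (v : E4) :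
    |Kerr.nullCovector a y v| ≤ 2 * ‖v‖ := by
  have hl := Kerr.sum_sq_nullCovectorFun hy
  rw [Kerr.nullCovector, E4.covector_apply, Fin.sum_univ_four, Kerr.nullCovectorFun_apply_zero, one_mul]
  have hn : ‖v‖ ^ 2 = v 0 ^ 2 + v 1 ^ 2 + v 2 ^ 2 + v 3 ^ 2 := by
    rw [EuclideanSpace.real_norm_sq_eq, Fin.sum_univ_four]
  have h0 := TameCensorship.Negative.abs_apply_le_norm v 0
  set l1 := Kerr.nullCovectorFun a y 1
  set l2 := Kerr.nullCovectorFun a y 2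
  set l3 := Kerr.nullCovectorFun a y 3
  -- Cauchy–Schwarz for the spatial part
  have hcs : (l1 * v 1 + l2 * v 2 + l3 * v 3) ^ 2 ≤ v 1 ^ 2 + v 2 ^ 2 + v 3 ^ 2 := by
    nlinarith [sq_nonneg (l1 * v 2 - l2 * v 1), sq_nonneg (l1 * v 3 - l3 * v 1),
      sq_nonneg (l2 * v 3 - l3 * v 2)]
  have hsp : |l1 * v 1 + l2 * v 2 + l3 * v 3| ≤ ‖v‖ := by
    rw [← Real.sqrt_sq_eq_abs, ← Real.sqrt_sq (norm_nonneg v)]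
    exact Real.sqrt_le_sqrt (by nlinarith [sq_nonneg (v 0)])
  calc |v 0 + l1 * v 1 + l2 * v 2 + l3 * v 3| = |v 0 + (l1 * v 1 + l2 * v 2 + l3 * v 3)| := by ring_nf
    _ ≤ |v 0| + |l1 * v 1 + l2 * v 2 + l3 * v 3| := abs_add_le _ _
    _ ≤ ‖v‖ + ‖v‖ := add_le_add h0 hsp
    _ = 2 * ‖v‖ := by ring

/-- **`‖g_{1,a}(y) − η‖ ≤ 8/r_a(y)`**: `g − η = 2H ℓ ⊗ ℓ` with `0 ≤ H ≤ 1/r` and `‖ℓ‖ ≤ 2`.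
Visser arXiv:0706.0622, (32)–(35). [folklore] -/
theorem norm_ksPert_one_le {a : ℝ} {y : E4} (hy : 0 < Kerr.radius a y) :
    ‖Kerr.bilin 1 a y - Minkowski.bilin‖ ≤ 8 / Kerr.radius a y := by
  rw [Kerr.ksPert_eq]
  have hH0 : 0 ≤ Kerr.scalarH 1 a y := Kerr.scalarH_nonneg zero_le_one a y
  have hH1 : Kerr.scalarH 1 a y ≤ 1 / Kerr.radius a y := Kerr.scalarH_le_div zero_le_one a hy
  have hT : ‖E4.tmul (Kerr.nullCovector a y) (Kerr.nullCovector a y)‖ ≤ 4 := by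
    refine ContinuousLinearMap.opNorm_le_bound₂ _ (by norm_num) fun v w ↦ ?_
    rw [E4.tmul_apply, Real.norm_eq_abs, abs_mul]
    calc |Kerr.nullCovector a y v| * |Kerr.nullCovector a y w| ≤ (2 * ‖v‖) * (2 * ‖w‖) :=
          mul_le_mul (abs_nullCovector_le hy v) (abs_nullCovector_le hy w) (abs_nonneg _) (by positivity)
      _ = 4 * ‖v‖ * ‖w‖ := by ring
  rw [norm_smul, Real.norm_eq_abs, abs_of_nonneg (by positivity)]
  calc 2 * Kerr.scalarH 1 a y * ‖E4.tmul (Kerr.nullCovector a y) (Kerr.nullCovector a y)‖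
      ≤ 2 * (1 / Kerr.radius a y) * 4 := by gcongr
    _ = 8 / Kerr.radius a y := by ring

/-- Linearity in the mass: `g_{M,a} = η + M (g_{1,a} − η)`. Visser arXiv:0706.0622, (33). [folklore] -/
theorem kerr_bilin_eq_add_smul_ksPert (M a : ℝ) (x : E4) :
    Kerr.bilin M a x = Minkowski.bilin + M • (Kerr.bilin 1 a x - Minkowski.bilin) := by
  rw [Kerr.ksPert_eq, smul_smul]
  have hH : 2 * Kerr.scalarH M a x = M * (2 * Kerr.scalarH 1 a x) := by
    unfold Kerr.scalarH
    ring
  rw [← hH, ← Kerr.ksPert_eq, add_sub_cancel]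


section Horizon

variable {ν : ℝ} {B B' : E4 →L[ℝ] E4}
  (hB : ∀ w : E4, B w = w + ((ν - 1) * w 3) • E4.basisVector 3)
  (hB' : ∀ w : E4, B' w = w + ((ν⁻¹ - 1) * w 3) • E4.basisVector 3)
  {G : E4 → E4 →L[ℝ] E4 →L[ℝ] ℝ}
  (hG : ∀ y v w, G y v w = Kerr.bilin ((1 + ν ^ 2) / (2 * ν)) 1 (B y) (B v) (B w))

/-- The differential of the Kerr–Schild radius in coordinates:
`dr_a(x)(w) = (r²(x¹w¹ + x²w² + x³w³) + a² x³ w³)/(r Σ)`, `Σ = blSigma a x⃗` (`Kerr.radiusGrad_apply_sum`).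
Visser arXiv:0706.0622, (35). [folklore] -/
theorem radiusGrad_spatial_apply (a : ℝ) (x w : E4) :
    Kerr.radiusGrad a (E4.spatial x) (E4.spatial w) =
      (Kerr.radius a x ^ 2 * (x 1 * w 1 + x 2 * w 2 + x 3 * w 3) + a ^ 2 * x 3 * w 3) /
        (Kerr.radius a x * Kerr.blSigma a (E4.spatial x)) := by
  rw [Kerr.radiusGrad_apply_sum, Fin.sum_univ_three, Kerr.radiusGradVec_apply, Kerr.radiusGradVec_apply,
    Kerr.radiusGradVec_apply, Kerr.radius_ofTimeSpace_spatial]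
  simp only [E4.spatial_apply, Fin.succ_zero_eq_one, Fin.succ_one_eq_two, show ((2 : Fin 3).succ : Fin 4) = 3
    from rfl, show (0 : Fin 3) ≠ 2 by decide, show (1 : Fin 3) ≠ 2 by decide, if_false, if_true, add_zero]
  ring

include hB hB' hG in
/-- **The red-shift scalar of `G` vanishes ON the boundary spheroid `{r_ν = 1}`**:
`dr_ν(G⁻¹dr_ν)(x) = c² Δ₁(ν)/Σ₁ = 0` with `c = Σ₁/(νΣ₀)`, because `dr_ν(x) ∘ B⁻¹ = c · dr_1(Bx)` is conormal
to the inner horizon `{r_1 = ν}` of `g_{M₁,1}`, where `g^{rr} = Δ₁/Σ₁`, `Δ₁(ν) = ν² − 2M₁ν + 1 = 0`.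
O'Neill 1995, §2.5. [folklore] -/
theorem squeezed_redShift_boundary (hν0 : 0 < ν) {x : E4} (hx : Kerr.radius ν x = 1)
    (hGi : (G x).IsInvertible) :
    fderiv ℝ (Kerr.radius ν) x (MetricCoord.sharpAt G x (fderiv ℝ (Kerr.radius ν) x)) = 0 := by
  have hν : ν ≠ 0 := hν0.ne'
  have hr0 : 0 < Kerr.radius ν x := by rw [hx]; exact one_pos
  have hy : Kerr.radius 1 (B x) = ν := (radius_squeeze_eq_iff hB hν0 x).2 hx
  have hy0 : 0 < Kerr.radius 1 (B x) := by rw [hy]; exact hν0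
  have hd : fderiv ℝ (Kerr.radius ν) x = (Kerr.radiusGrad ν (E4.spatial x)).comp E4.spatial :=
    (Kerr.hasFDerivAt_radius hr0).fderiv
  have hS0 : 0 < Kerr.blSigma ν (E4.spatial x) := Kerr.blSigma_spatial_pos hr0
  have hS1 : 0 < Kerr.blSigma 1 (E4.spatial (B x)) := Kerr.blSigma_spatial_pos hy0
  set c : ℝ := Kerr.blSigma 1 (E4.spatial (B x)) / (ν * Kerr.blSigma ν (E4.spatial x)) with hc
  -- the two differentials in coordinates
  have hα : ∀ w : E4, fderiv ℝ (Kerr.radius ν) x w =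
      (x 1 * w 1 + x 2 * w 2 + (1 + ν ^ 2) * x 3 * w 3) / Kerr.blSigma ν (E4.spatial x) := by
    intro w
    rw [hd, ContinuousLinearMap.comp_apply, radiusGrad_spatial_apply, hx]
    field_simp
    ring
  have hα₁ : ∀ w : E4, Kerr.radiusGrad 1 (E4.spatial (B x)) (E4.spatial w) =
      (ν * x 1 * w 1 + ν * x 2 * w 2 + (1 + ν ^ 2) * x 3 * w 3) / Kerr.blSigma 1 (E4.spatial (B x)) := by
    intro w
    rw [radiusGrad_spatial_apply, hy, squeeze_apply_three hB, squeeze_apply_of_ne_three hB x (by decide),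
      squeeze_apply_of_ne_three hB x (by decide)]
    field_simp
    ring
  -- `dr_ν(x) ∘ B⁻¹ = c · dr_1(Bx)`
  have hkey : ∀ w : E4, fderiv ℝ (Kerr.radius ν) x (B' w) = c * Kerr.radiusGrad 1 (E4.spatial (B x)) (E4.spatial w) := by
    intro w
    rw [hα, hα₁, squeeze_apply_three hB', squeeze_apply_of_ne_three hB' w (by decide),
      squeeze_apply_of_ne_three hB' w (by decide), hc]
    field_simp
  -- `G⁻¹ dr_ν = B⁻¹ (c W₁)`
  set W := Kerr.radiusGradVector ((1 + ν ^ 2) / (2 * ν)) 1 (B x) with hW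
  have hsharp : MetricCoord.sharpAt G x (fderiv ℝ (Kerr.radius ν) x) = B' (c • W) := by
    refine MetricCoord.sharpAt_eq_of_forall hGi fun w ↦ ?_
    rw [hG, squeeze_inverse_apply hB hB' hν, map_smul, smul_apply, smul_eq_mul,
      Kerr.bilin_radiusGradVector hy0]
    have := hkey (B w)
    rw [inverse_squeeze_apply hB hB' hν] at this
    rw [this]
  rw [hsharp, hkey, map_smul, map_smul, smul_eq_mul, ← Kerr.bilin_radiusGradVector hy0,
    Kerr.bilin_radiusGradVector_self hy0, hy]
  have hΔ : ν ^ 2 - 2 * ((1 + ν ^ 2) / (2 * ν)) * ν + 1 ^ 2 = 0 := by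
    field_simp
    ring
  rw [hΔ, zero_div, mul_zero, mul_zero]

include hB hG in
/-- The red-shift scalar of `G` is stationary (so are `dr_ν` and `G`). [folklore] -/
theorem squeezed_redShift_add_smul_basisVector_zero {x : E4} (hx : 0 < Kerr.radius ν x) (s : ℝ) :
    fderiv ℝ (Kerr.radius ν) (x + s • E4.basisVector 0) (MetricCoord.sharpAt G (x + s • E4.basisVector 0)
      (fderiv ℝ (Kerr.radius ν) (x + s • E4.basisVector 0))) =
      fderiv ℝ (Kerr.radius ν) x (MetricCoord.sharpAt G x (fderiv ℝ (Kerr.radius ν) x)) := by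
  have hsp : E4.spatial (x + s • E4.basisVector 0) = E4.spatial x := by
    rw [map_add, map_smul, E4.spatial_basisVector_zero, smul_zero, add_zero]
  have hx' : 0 < Kerr.radius ν (x + s • E4.basisVector 0) := by rwa [Kerr.radius_eq_of_spatial_eq ν hsp]
  have hd : fderiv ℝ (Kerr.radius ν) (x + s • E4.basisVector 0) = fderiv ℝ (Kerr.radius ν) x := by
    rw [(Kerr.hasFDerivAt_radius hx').fderiv, (Kerr.hasFDerivAt_radius hx).fderiv, hsp]
  have hGs : MetricCoord.sharpAt G (x + s • E4.basisVector 0) = MetricCoord.sharpAt G x := by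
    have hst : G (x + s • E4.basisVector 0) = G x := by
      ext v w
      rw [hG, hG, squeeze_add_smul_basisVector_zero hB, Kerr.bilin_add_smul_basisVector_zero]
    unfold MetricCoord.sharpAt
    rw [hst]
  rw [hd, hGs]

include hB hB' hG in
/-- **The inner boundary `{r_ν = 1}` is null for `G`, uniformly** (hypothesis H7 of the no-hair stub):
for every `ε > 0` there is `δ > 0` with `|dr_ν(G⁻¹dr_ν)| ≤ ε` on `{1 < r_ν < 1 + δ}`. The scalar is
stationary, continuous on `B⁻¹{r_1 > 0} ∩ {r_ν > 0} ⊇ {r_ν ≥ 1}` and zero on `{r_ν = 1}`; on the compact slice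
`{x⁰ = 0, 1 ≤ r_ν ≤ 2}` the closed set `{|F| ≥ ε}` has a minimal radius `m > 1`; take `δ = min (m − 1) 1`.
[folklore] -/
theorem squeezed_null_boundary (hν0 : 0 < ν) (hν1 : ν < 1)
    (hGc : ContDiffOn ℝ ∞ G (B ⁻¹' (Kerr.region 1 0 : Set E4))) {ε : ℝ} (hε : 0 < ε) :
    ∃ δ : ℝ, 0 < δ ∧ ∀ x : E4, 1 < Kerr.radius ν x → Kerr.radius ν x < 1 + δ →
      |fderiv ℝ (Kerr.radius ν) x (MetricCoord.sharpAt G x (fderiv ℝ (Kerr.radius ν) x))| ≤ ε := by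
  have hν : ν ≠ 0 := hν0.ne'
  set F : E4 → ℝ := fun x ↦ fderiv ℝ (Kerr.radius ν) x (MetricCoord.sharpAt G x (fderiv ℝ (Kerr.radius ν) x))
    with hF
  set V : Set E4 := B ⁻¹' (Kerr.region 1 0 : Set E4) with hV
  have hVmem : ∀ x : E4, x ∈ V ↔ 0 < Kerr.radius 1 (B x) := fun x ↦ by
    rw [hV, mem_preimage, SetLike.mem_coe, Kerr.mem_region, max_self]
  have hmetric : MetricCoord.IsMetricOn G V :=
    { isOpen := (Kerr.region 1 0).isOpen.preimage B.continuous
      contDiffOn := hGc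
      symm := fun x _ v w ↦ by rw [hG, hG, Kerr.bilin_symm]
      isInvertible := fun x hx ↦ isInvertible_squeezed hB hB' hG hν ((hVmem x).1 hx) }
  set U : Set E4 := {x | 0 < Kerr.radius ν x} ∩ V with hU
  -- continuity of `F` on `U`
  have hα : ContinuousOn (fderiv ℝ (Kerr.radius ν)) {x : E4 | 0 < Kerr.radius ν x} := fun x hx ↦
    ((Kerr.contDiffAt_radius (n := 1) hx).fderiv_right (m := 0) (by norm_num)).continuousAt.continuousWithinAt
  have hS : ContinuousOn (MetricCoord.sharpAt G) V := hmetric.contDiffOn_sharpAt.continuousOn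
  have hFc : ContinuousOn F U :=
    (hα.mono inter_subset_left).clm_apply ((hS.mono inter_subset_right).clm_apply (hα.mono inter_subset_left))
  -- the compact slice `K = {x⁰ = 0, 1 ≤ r_ν ≤ 2} ⊆ U`
  set K : Set E4 := {x | x 0 = 0} ∩ {x | 1 ≤ Kerr.radius ν x} ∩ {x | Kerr.radius ν x ≤ 2} with hK
  have hc0 : Continuous fun x : E4 ↦ x 0 := (EuclideanSpace.proj (0 : Fin 4) : E4 →L[ℝ] ℝ).continuous
  have hKcl : IsClosed K :=
    ((isClosed_eq hc0 continuous_const).inter (isClosed_le continuous_const (Kerr.continuous_radius ν))).inter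
      (isClosed_le (Kerr.continuous_radius ν) continuous_const)
  have hKc : IsCompact K := by
    refine Metric.isCompact_of_isClosed_isBounded hKcl ?_
    refine (Metric.isBounded_closedBall (x := (0 : E4)) (r := 3)).subset fun x hx ↦ ?_
    rw [Metric.mem_closedBall, dist_zero_right]
    have h1 := Kerr.spatialNorm_sq_sub_sq_le_radius_sq ν x
    have h2 : Kerr.radius ν x ^ 2 ≤ 2 ^ 2 := pow_le_pow_left₀ (Kerr.radius_nonneg ν x) hx.2 2
    have h3 : ‖x‖ ^ 2 = E4.spatialNorm x ^ 2 := by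
      rw [EuclideanSpace.real_norm_sq_eq, Fin.sum_univ_four, E4.spatialNorm_sq, show x 0 = 0 from hx.1.1]
      ring
    have hν2 : ν ^ 2 ≤ 1 := by nlinarith
    exact le_of_pow_le_pow_left₀ two_ne_zero (by norm_num) (by nlinarith)
  have hKU : K ⊆ U := fun x hx ↦
    ⟨show 0 < Kerr.radius ν x from one_pos.trans_le hx.1.2,
      (hVmem x).2 (hν0.trans_le (nu_le_radius_squeeze hB hν0 hx.1.2))⟩
  -- the closed set `S = K ∩ {ε ≤ |F|}` misses the boundary
  set S : Set E4 := K ∩ F ⁻¹' {t : ℝ | ε ≤ |t|} with hSdef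
  have hScl : IsClosed S :=
    (hFc.mono hKU).preimage_isClosed_of_isClosed hKcl (isClosed_le continuous_const continuous_abs)
  have hSc : IsCompact S := hKc.of_isClosed_subset hScl inter_subset_left
  have hSbdry : ∀ x ∈ S, 1 < Kerr.radius ν x := by
    rintro x ⟨hxK, hxF⟩
    rcases (show 1 ≤ Kerr.radius ν x from hxK.1.2).lt_or_eq with h | h
    · exact h
    · exfalso
      have hGi : (G x).IsInvertible := hmetric.isInvertible x (hKU hxK).2
      have h0 : F x = 0 := squeezed_redShift_boundary hB hB' hG hν0 h.symm hGi
      rw [mem_preimage, mem_setOf_eq, h0, abs_zero] at hxF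
      linarith
  -- a radius threshold `m > 1` below which `S` has no points
  obtain ⟨m, hm1, hmS⟩ : ∃ m : ℝ, 1 < m ∧ ∀ x ∈ S, m ≤ Kerr.radius ν x := by
    rcases S.eq_empty_or_nonempty with hSe | hSne
    · exact ⟨2, one_lt_two, fun x hx ↦ by rw [hSe] at hx; exact hx.elim⟩
    · obtain ⟨xm, hxm, hmin⟩ := hSc.exists_isMinOn hSne (Kerr.continuous_radius ν).continuousOn
      exact ⟨Kerr.radius ν xm, hSbdry xm hxm, fun x hx ↦ hmin hx⟩
  refine ⟨min (m - 1) 1, lt_min (by linarith) one_pos, fun x hx1 hx2 ↦ ?_⟩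
  -- normalise the time coordinate and conclude
  have hx0 : 0 < Kerr.radius ν x := one_pos.trans hx1
  set x' : E4 := x + (-x 0) • E4.basisVector 0 with hx'
  have hsp : E4.spatial x' = E4.spatial x := by
    rw [hx', map_add, map_smul, E4.spatial_basisVector_zero, smul_zero, add_zero]
  have hr' : Kerr.radius ν x' = Kerr.radius ν x := Kerr.radius_eq_of_spatial_eq ν hsp
  have hx'0 : x' 0 = 0 := by
    rw [hx', PiLp.add_apply, PiLp.smul_apply, show (E4.basisVector 0 : E4) 0 = 1 by simp [E4.basisVector]]
    simp
  have hx'K : x' ∈ K :=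
    ⟨⟨hx'0, show 1 ≤ Kerr.radius ν x' by rw [hr']; exact hx1.le⟩,
      show Kerr.radius ν x' ≤ 2 by rw [hr']; linarith [min_le_right (m - 1) 1]⟩
  have hFx : F x = F x' := (squeezed_redShift_add_smul_basisVector_zero hB hG hx0 (-x 0)).symm
  show |F x| ≤ ε
  rw [hFx]
  by_contra hlt
  have hx'S : x' ∈ S := ⟨hx'K, by rw [mem_preimage, mem_setOf_eq]; linarith [le_of_lt (not_le.1 hlt)]⟩
  have := hmS x' hx'S
  rw [hr'] at this
  linarith [min_le_left (m - 1) 1]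

end Horizon

/-- **Summary (registered sub-goal): the inner boundary `{r_ν = 1}` of the squeezed form is null, uniformly**
(hypothesis H7 of the no-hair stub for the masquerade). [folklore] -/
theorem innerHorizonMasquerade_nullBoundary : ∀ ν : ℝ, 0 < ν → ν < 1 → ∀ (B B' : E4 →L[ℝ] E4) (G : E4 → E4 →L[ℝ] E4 →L[ℝ] ℝ), (∀ w : E4, B w = w + ((ν - 1) * w 3) • E4.basisVector 3) → (∀ w : E4, B' w = w + ((ν⁻¹ - 1) * w 3) • E4.basisVector 3) → (∀ y v w : E4, G y v w = Kerr.bilin ((1 + ν ^ 2) / (2 * ν)) 1 (B y) (B v) (B w)) → ContDiffOn ℝ ∞ G (B ⁻¹' (Kerr.region 1 0 : Set E4)) → ∀ ε : ℝ, 0 < ε → ∃ δ : ℝ, 0 < δ ∧ ∀ x : E4, 1 < Kerr.radius ν x → Kerr.radius ν x < 1 + δ → |fderiv ℝ (Kerr.radius ν) x (MetricCoord.sharpAt G x (fderiv ℝ (Kerr.radius ν) x))| ≤ ε :=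
  fun _ hν0 hν1 _ _ _ hB hB' hG hGc _ hε ↦ squeezed_null_boundary hB hB' hG hν0 hν1 hGc hε

end Summit.FinalStateConjecture.FinalStateConjecture.Theorems.ClusterCompleteness

end
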